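import Mathlib
import HarnessLib
import Summits.NavierStokesRegularity.NavierStokesRegularity.Theorems.TypeILiouvilleStrainLedgerOsgoodTypeIStrain

/-!
# TypeILiouvilleStrainLedgerOsgoodTemporalGauge — crux (L) stmt-NavierStokesRegularity-10661 `TypeIliouvilleL`,
# registered stub `stub_typeIAncientLiouville_knssGauge` (door stmt-4050): TEMPORALLY GAUGED CELLS ARE OSGOOD CELLS,
# AND THE CERTIFICATE MAY BE EVENTUAL AND ALIGNED

Helper for stmt-NavierStokesRegularity-10661 (`--supports`); theorems only, no definitions, no named-fact hypotheses;
closes no item; Navier–Stokes regularity is NOT proved here (leafhand seat of the EulerZoomLiouville route).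
Unification of the two strain-axis criteria on the Type-I ancient mild class: the temporal-gauge certificate of
`TypeILiouvilleStrainLedgerTypeIGauge.typeI_eq_zero_of_temporalGauge` (`((−t)⟪∇u ξ,ξ⟫ − 1 + δ)·g ≤ (−t)·g′`, `g ≥ 1`
smooth, FOR ALL `t < 0`, engine: stretching-certificate comparison) and the Osgood floor of
`TypeILiouvilleStrainLedgerOsgoodTypeIStrain.typeI_eq_zero_of_alignedDeficit_divergent` (divergent deficit of a
continuous aligned-stretching majorant ON A FAR PAST, engine: vorticity ledger).

* `tendsto_deficit_of_temporalGauge` — real-variable core: for `g` smooth on `(−∞,0)`, `g ≥ 1`, `δ > 0`, `T < 0`, the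
  stretching majorant `a(τ) = 1 − δ + (−τ) g′(τ)/g(τ)` (frozen above `T`) has deficit integral
  `∫_s^T (1 − a)/(−τ) = δ log((−s)/(−T)) − log(g(T)/g(s)) ≥ δ log((−s)/(−T)) − log g(T) → +∞`.
* `typeI_eq_zero_of_eventual_alignedTemporalGauge` — **EVENTUAL, ALIGNED CERTIFICATE THEOREM**: `IsTypeIAncientMild C u`
  with a temporal gauge `g` and `δ > 0` such that ONLY FOR `τ < T` and ONLY ALONG THE VORTICITY
  `((−τ)⟪∇u(τ,y) ω, ω⟫ − (1−δ)‖ω‖²)·g(τ) ≤ (−τ)·g′(τ)·‖ω‖²` (`ω = curl u(τ,y)`) ⟹ `u ≡ 0`.  Strictly extends the tree's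
  certificate theorem (all `t < 0`, all unit `ξ`) — and exhibits every temporally gauged cell as an Osgood cell.
* `typeI_eq_zero_of_eventual_temporalGauge` — the all-directions unit-vector form on a far past;
  `knssGauge_eq_zero_of_eventual_alignedTemporalGauge` — by the registered stub's verbatim binders.

HONEST LABEL: bookkeeping; door 4050 itself stays open; nothing here proves a registered stub, (L), or NS regularity;
rung 0. [cite: KochNadirashviliSereginSverak2009, §4 p. 8 (arXiv:0709.3599)] [cite: MajdaBertozziCUP2002, eq. (3.80)]
[cite: Constantin1994, §2]
-/

noncomputable section
open MeasureTheory Filter Set Function Metric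
open scoped Topology RealInnerProductSpace ENNReal NNReal
open Literature.Analysis Literature.Analysis.FluidPDE Literature.Analysis.UnboundedOperators
set_option linter.dupNamespace false
namespace Summit.NavierStokesRegularity.NavierStokesRegularity.Theorems.TypeILiouvilleStrainLedger

/-! ## §1 Real-variable core: the deficit of a temporally gauged majorant diverges -/

/-- For `g` smooth on `(−∞,0)` with `g ≥ 1`, `δ > 0` and `T < 0`, the frozen temporal-gauge majorant
`a(τ) = 1 − δ + (−m) g′(m)/g(m)`, `m = min τ T`, is continuous on `ℝ`. [folklore] -/
theorem continuous_temporalGaugeMajorant {g : ℝ → ℝ} (hg : ContDiffOn ℝ (⊤ : ℕ∞) g (Iio 0))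
    (hg1 : ∀ t < 0, 1 ≤ g t) (δ : ℝ) {T : ℝ} (hT : T < 0) :
    Continuous fun τ : ℝ => 1 - δ + (-min τ T) * deriv g (min τ T) / g (min τ T) := by
  have hm : Continuous fun τ : ℝ => min τ T := continuous_id.min continuous_const
  have hmI : ∀ τ : ℝ, min τ T ∈ Iio (0 : ℝ) := fun τ => lt_of_le_of_lt (min_le_right _ _) hT
  have hgc : Continuous fun τ : ℝ => g (min τ T) := hg.continuousOn.comp_continuous hm hmI
  have hdc : Continuous fun τ : ℝ => deriv g (min τ T) :=
    (hg.continuousOn_deriv_of_isOpen isOpen_Iio (by exact_mod_cast le_top)).comp_continuous hm hmI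
  refine continuous_const.add ((hm.neg.mul hdc).div hgc fun τ => ?_)
  exact (lt_of_lt_of_le zero_lt_one (hg1 _ (hmI τ))).ne'

/-- **Temporally gauged ⟹ divergent deficit.**  For `g` smooth on `(−∞,0)`, `g ≥ 1`, `δ > 0`, `T < 0`: with
`a(τ) = 1 − δ + (−m) g′(m)/g(m)` (`m = min τ T`), `∫_s^T (1 − a(τ)) dτ/(−τ) = δ(log(−s) − log(−T)) − (log g(T) − log g(s))`
for `s < T`, which is `≥ δ(log(−s) − log(−T)) − log g(T) → +∞` as `s → −∞`. [folklore] -/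
theorem tendsto_deficit_of_temporalGauge {g : ℝ → ℝ} (hg : ContDiffOn ℝ (⊤ : ℕ∞) g (Iio 0))
    (hg1 : ∀ t < 0, 1 ≤ g t) {δ : ℝ} (hδ : 0 < δ) {T : ℝ} (hT : T < 0) :
    Tendsto (fun s : ℝ => ∫ τ in s..T,
      (1 - (1 - δ + (-min τ T) * deriv g (min τ T) / g (min τ T))) / (-τ)) atBot atTop := by
  have hgpos : ∀ t < 0, 0 < g t := fun t ht => lt_of_lt_of_le zero_lt_one (hg1 t ht)
  have hdiff : DifferentiableOn ℝ g (Iio 0) := hg.differentiableOn (by simp)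
  have hderivc : ContinuousOn (deriv g) (Iio 0) := hg.continuousOn_deriv_of_isOpen isOpen_Iio (by exact_mod_cast le_top)
  -- closed form for `s < T`
  have hclosed : ∀ s < T, ∫ τ in s..T, (1 - (1 - δ + (-min τ T) * deriv g (min τ T) / g (min τ T))) / (-τ) =
      δ * (Real.log (-s) - Real.log (-T)) - (Real.log (g T) - Real.log (g s)) := by
    intro s hs
    have hmem : ∀ τ ∈ uIcc s T, τ < 0 := by
      intro τ hτ; rw [uIcc_of_le hs.le] at hτ; exact lt_of_le_of_lt hτ.2 hT
    have hcongr : ∫ τ in s..T, (1 - (1 - δ + (-min τ T) * deriv g (min τ T) / g (min τ T))) / (-τ) =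
        ∫ τ in s..T, (δ * (1 / (-τ)) - deriv g τ / g τ) := by
      refine intervalIntegral.integral_congr fun τ hτ => ?_
      have hτ0 : τ < 0 := hmem τ hτ
      have hτT : τ ≤ T := by rw [uIcc_of_le hs.le] at hτ; exact hτ.2
      have hne : τ ≠ 0 := hτ0.ne
      have hgne : g τ ≠ 0 := (hgpos τ hτ0).ne'
      simp only [min_eq_left hτT]
      field_simp
      ring
    have hcont1 : ContinuousOn (fun τ : ℝ => δ * (1 / (-τ))) (uIcc s T) :=
      continuousOn_const.mul (continuousOn_const.div continuousOn_id.neg fun τ hτ => (neg_pos.2 (hmem τ hτ)).ne')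
    have hcont2 : ContinuousOn (fun τ : ℝ => deriv g τ / g τ) (uIcc s T) :=
      (hderivc.mono fun τ hτ => hmem τ hτ).div (hg.continuousOn.mono fun τ hτ => hmem τ hτ)
        fun τ hτ => (hgpos τ (hmem τ hτ)).ne'
    have hderiv : ∀ τ ∈ uIcc s T, HasDerivAt (fun r => Real.log (g r)) (deriv g τ / g τ) τ := by
      intro τ hτ
      have hτ0 : τ < 0 := hmem τ hτ
      have hd : HasDerivAt g (deriv g τ) τ :=
        ((hdiff.differentiableAt (Iio_mem_nhds hτ0)).hasDerivAt)
      exact hd.log (hgpos τ hτ0).ne'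
    rw [hcongr, intervalIntegral.integral_sub hcont1.intervalIntegrable hcont2.intervalIntegrable,
      intervalIntegral.integral_const_mul, integral_one_div_neg_eq_log hs hT,
      intervalIntegral.integral_eq_sub_of_hasDerivAt hderiv hcont2.intervalIntegrable]
  -- lower bound and divergence
  have hlow : Tendsto (fun s : ℝ => δ * (Real.log (-s) - Real.log (-T)) - Real.log (g T)) atBot atTop := by
    refine tendsto_atTop_add_const_right _ _ (Tendsto.const_mul_atTop hδ (tendsto_atTop_add_const_right _ _ ?_))
    exact Real.tendsto_log_atTop.comp tendsto_neg_atBot_atTop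
  refine tendsto_atTop_mono' atBot ?_ hlow
  filter_upwards [eventually_lt_atBot T] with s hs
  rw [hclosed s hs]
  have hgs : 0 ≤ Real.log (g s) := Real.log_nonneg (hg1 s (hs.trans hT))
  linarith

/-! ## §2 Eventual, aligned temporal-gauge certificate on the Type-I class -/

/-- **EVENTUAL, ALIGNED TEMPORAL-GAUGE CERTIFICATE THEOREM.**  Let `u` be a Type-I ancient mild field and `g` a temporal
gauge — smooth on `(−∞,0)`, `g ≥ 1` — with `δ > 0` and `T < 0` such that for all `τ < T` and all `y`, writing
`ω = curl u(τ,y)`: `((−τ)⟪∇u(τ,y) ω, ω⟫ − (1 − δ)‖ω‖²)·g(τ) ≤ (−τ)·g′(τ)·‖ω‖²`.  Then `u ≡ 0`: the aligned stretching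
number is majorised by `a(τ) = 1 − δ + (−τ)g′/g` on `τ < T`, whose deficit integral diverges (§1), and the aligned
Osgood floor `typeI_eq_zero_of_alignedDeficit_divergent` concludes.  Extends
`TypeILiouvilleStrainLedgerTypeIGauge.typeI_eq_zero_of_temporalGauge` (certificate for all `t < 0` and all unit `ξ`).
[cite: KochNadirashviliSereginSverak2009, §4 p. 8 (arXiv:0709.3599)] [cite: Constantin1994, §2] -/
theorem typeI_eq_zero_of_eventual_alignedTemporalGauge {C : ℝ}
    {u : ℝ → EuclideanSpace ℝ (Fin 3) → EuclideanSpace ℝ (Fin 3)} (hu : IsTypeIAncientMild C u)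
    {g : ℝ → ℝ} (hg : ContDiffOn ℝ (⊤ : ℕ∞) g (Iio 0)) (hg1 : ∀ t < 0, 1 ≤ g t)
    {δ T : ℝ} (hδ : 0 < δ) (hT : T < 0)
    (hcert : ∀ τ < T, ∀ y : EuclideanSpace ℝ (Fin 3),
      ((-τ) * ⟪fderiv ℝ (u τ) y (curl (u τ) y), curl (u τ) y⟫ - (1 - δ) * ‖curl (u τ) y‖ ^ 2) * g τ ≤
        (-τ) * deriv g τ * ‖curl (u τ) y‖ ^ 2) :
    ∀ t < 0, ∀ x, u t x = 0 := by
  have hgpos : ∀ t < 0, 0 < g t := fun t ht => lt_of_lt_of_le zero_lt_one (hg1 t ht)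
  refine typeI_eq_zero_of_alignedDeficit_divergent hu hT (continuous_temporalGaugeMajorant hg hg1 δ hT)
    (fun τ hτ y => ?_) (tendsto_deficit_of_temporalGauge hg hg1 hδ hT)
  have hτ0 : 0 < -τ := by linarith
  have hgt : 0 < g τ := hgpos τ (by linarith)
  have h := hcert τ hτ y
  simp only [min_eq_left hτ.le]
  -- divide the certificate by `g τ > 0` and `−τ > 0`
  rw [div_mul_eq_mul_div, le_div_iff₀ hτ0]
  have h2 : (-τ) * ⟪fderiv ℝ (u τ) y (curl (u τ) y), curl (u τ) y⟫ ≤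
      (1 - δ + (-τ) * deriv g τ / g τ) * ‖curl (u τ) y‖ ^ 2 := by
    rw [show (1 - δ + (-τ) * deriv g τ / g τ) * ‖curl (u τ) y‖ ^ 2 =
        ((1 - δ) * ‖curl (u τ) y‖ ^ 2 * g τ + (-τ) * deriv g τ * ‖curl (u τ) y‖ ^ 2) / g τ by
      field_simp]
    rw [le_div_iff₀ hgt]
    linarith
  linarith [h2]

/-- **EVENTUAL TEMPORAL-GAUGE CERTIFICATE THEOREM, unit-vector form.**  The hypothesis of the tree's certificate theorem,
`((−τ)⟪∇u(τ,y)ξ,ξ⟫ − 1 + δ)·g(τ) ≤ (−τ)·g′(τ)` for unit `ξ`, assumed ONLY FOR `τ < T`, already gives `u ≡ 0`.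
[cite: KochNadirashviliSereginSverak2009, §4 p. 8 (arXiv:0709.3599)] -/
theorem typeI_eq_zero_of_eventual_temporalGauge {C : ℝ}
    {u : ℝ → EuclideanSpace ℝ (Fin 3) → EuclideanSpace ℝ (Fin 3)} (hu : IsTypeIAncientMild C u)
    {g : ℝ → ℝ} (hg : ContDiffOn ℝ (⊤ : ℕ∞) g (Iio 0)) (hg1 : ∀ t < 0, 1 ≤ g t)
    {δ T : ℝ} (hδ : 0 < δ) (hT : T < 0)
    (hcert : ∀ τ < T, ∀ y ξ : EuclideanSpace ℝ (Fin 3), ‖ξ‖ = 1 →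
      ((-τ) * ⟪fderiv ℝ (u τ) y ξ, ξ⟫ - 1 + δ) * g τ ≤ (-τ) * deriv g τ) :
    ∀ t < 0, ∀ x, u t x = 0 := by
  refine typeI_eq_zero_of_eventual_alignedTemporalGauge hu hg hg1 hδ hT fun τ hτ y => ?_
  set ω : EuclideanSpace ℝ (Fin 3) := curl (u τ) y with hω
  by_cases hz : ω = 0
  · simp [hz]
  · have hn : 0 < ‖ω‖ := norm_pos_iff.2 hz
    set e : EuclideanSpace ℝ (Fin 3) := ‖ω‖⁻¹ • ω with he
    have hne : ‖e‖ = 1 := by rw [he, norm_smul, norm_inv, norm_norm, inv_mul_cancel₀ hn.ne']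
    have hωe : ω = ‖ω‖ • e := by
      rw [he, smul_smul, mul_inv_cancel₀ hn.ne', one_smul]
    have hinner : ⟪fderiv ℝ (u τ) y ω, ω⟫ = ‖ω‖ ^ 2 * ⟪fderiv ℝ (u τ) y e, e⟫ := by
      conv_lhs => rw [hωe]
      rw [map_smul, real_inner_smul_left, real_inner_smul_right]
      ring
    have h := hcert τ hτ y e hne
    have hg0 : 0 ≤ g τ := zero_le_one.trans (hg1 τ (by linarith))
    have hsq : 0 ≤ ‖ω‖ ^ 2 := sq_nonneg _
    -- multiply the unit certificate by `‖ω‖²`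
    have h2 := mul_le_mul_of_nonneg_right h hsq
    rw [hinner]
    nlinarith [h2]

/-- **By the registered stub's verbatim binders.**  The stub `stub_typeIAncientLiouville_knssGauge` HOLDS for every
`u` satisfying its literal KNSS-gauge hypotheses and admitting an EVENTUAL ALIGNED temporal-gauge certificate
(`g` smooth on `(−∞,0)`, `g ≥ 1`, `δ > 0`, `T < 0`, `((−τ)⟪∇u ω, ω⟫ − (1−δ)‖ω‖²)·g ≤ (−τ)·g′·‖ω‖²` for `τ < T`).
[cite: KochNadirashviliSereginSverak2009, §4 p. 8 (arXiv:0709.3599)] -/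
theorem knssGauge_eq_zero_of_eventual_alignedTemporalGauge (C : ℝ)
    (u : ℝ → EuclideanSpace ℝ (Fin 3) → EuclideanSpace ℝ (Fin 3))
    (hu : ContDiffOn ℝ (⊤ : ℕ∞) (Function.uncurry u) (Set.Iio 0 ×ˢ Set.univ) ∧
      (∀ t < 0, Literature.Analysis.FluidPDE.VectorCalculus.IsDivFree (u t)) ∧
      (∀ s t : ℝ, s < t → t < 0 → ∀ x, u t x = Literature.Analysis.FluidPDE.heatFlow (u s) (t - s) x -
        ∫ τ in Set.Ioo s t, ∫ y, Literature.Analysis.FluidPDE.oseenKernel (t - τ) (x - y) (u τ y) (u τ y)) ∧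
      Literature.Analysis.FluidPDE.HasTypeITimeDecay C u)
    {g : ℝ → ℝ} (hg : ContDiffOn ℝ (⊤ : ℕ∞) g (Iio 0)) (hg1 : ∀ t < 0, 1 ≤ g t)
    {δ T : ℝ} (hδ : 0 < δ) (hT : T < 0)
    (hcert : ∀ τ < T, ∀ y : EuclideanSpace ℝ (Fin 3),
      ((-τ) * ⟪fderiv ℝ (u τ) y (curl (u τ) y), curl (u τ) y⟫ - (1 - δ) * ‖curl (u τ) y‖ ^ 2) * g τ ≤
        (-τ) * deriv g τ * ‖curl (u τ) y‖ ^ 2) :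
    ∀ t < 0, ∀ x, u t x = 0 :=
  typeI_eq_zero_of_eventual_alignedTemporalGauge (isTypeIAncientMild_iff.2 hu) hg hg1 hδ hT hcert

end Summit.NavierStokesRegularity.NavierStokesRegularity.Theorems.TypeILiouvilleStrainLedger

end
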